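import Mathlib
import Summits.Ventures.PercRepro2.CrossAPrimeBernStep
import Summits.Ventures.PercRepro2.LeafRowPendantRootMirrorB

/-!
# The chain of open statements for row (LEAF-½) at a pendant root
(blind cell PercRepro2, p5 g33; `proofs/P5-OEDGE.md` §43, S4 §2.4 (s) addendum 25 (1))

`RBP1` is the single-edge case of the root-Bernstein positivity: along every random root edge
`e = {r, w}` (`w ∉ {a₂, v}`) the two middle Bernstein coefficients `3B₁ = E₁ + B₀` and
`3B₂ = E₂ + B₃` of the one-edge cubic are nonnegative, with no hypothesis.  The chain
`RBP1 ⟹ BernStep ⟹ 0 ≤ crossA′so` (`CrossAPrimeBernStep`) and the degree-one-root contraction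
`LeafRow_pendant_root_of_crossA'so` give row (LEAF-½) at a pendant root from either `BernStep`,
`MixedSign` or `RBP1` (**`LeafRow_pendant_root_of_bernStep`**, `…_of_mixedSign`, `…_of_rbp1`).
Own work; standard axioms.
-/

namespace Summit.Ventures.PercRepro2

open LeafRowPendantRootSO LeafStep LeafRowPendantRootMirrorB CrossAPrimeEdgeIdentities
  CrossAPrimeMixedSign CrossAPrimeBernStep

namespace CrossAPrimeChain

section Main

variable {V : Type*} {E : Type*} [Fintype E] [DecidableEq E] [Fintype V] [DecidableEq V]
  {R : Type*} [Field R] [LinearOrder R] [IsStrictOrderedRing R]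
variable {ends : E → Sym2 V}

/-- **The single-edge root-Bernstein positivity**: along every random root edge `e = {r, w}`
(`w ∉ {a₂, v}`), `0 ≤ 3B₁ (= E₁ + B₀)` and `0 ≤ 3B₂ (= E₂ + B₃)`, unconditionally. -/
def RBP1 (ends : E → Sym2 V) (o a₂ v b : V) : Prop :=
  ∀ (p : E → R) (r w : V) (e : E), IsProbVec p → ends e = s(r, w) → r ≠ w → w ≠ a₂ → w ≠ v →
    p e ≠ 0 → p e ≠ 1 →
    0 ≤ E1 p e ends o r a₂ v b + crossA'so (Function.update p e 0) ends o r a₂ v b ∧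
      0 ≤ E2 p e ends o r a₂ v b + crossA'so (Function.update p e 1) ends o r a₂ v b

omit [Fintype V] [DecidableEq V] [IsStrictOrderedRing R] in
/-- `RBP1` gives `BernStep`. -/
theorem bernStep_of_rbp1 {o a₂ v b : V} (H : RBP1 (R := R) ends o a₂ v b) :
    BernStep (R := R) ends o a₂ v b :=
  fun p r w e hp he hrw hw2 hwv h0 h1 _ _ => H p r w e hp he hrw hw2 hwv h0 h1

/-- **Row (LEAF-½) at a pendant root from `BernStep`**: the row at the open pin gives the row at
the pendant instance. -/
theorem LeafRow_pendant_root_of_bernStep {o a₂ v b : V} (H : BernStep (R := R) ends o a₂ v b)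
    {p : E → R} (hp : IsProbVec p) {e : E} {z : V} (hleaf : ∀ f, a₂ ∈ ends f → f = e)
    (hends : ends e = s(a₂, z)) {a₁ : V} (ho : o ≠ a₂) (h1 : a₁ ≠ a₂) (hv : v ≠ a₂) (hb : b ≠ a₂)
    (hrow : LeafRow (Function.update p e 1) ends o a₁ a₂ v b) : LeafRow p ends o a₁ a₂ v b :=
  LeafRow_pendant_root_of_crossA'so hp hleaf hends ho h1 hv hb hrow
    (crossA'so_nonneg_of_bernStep H (Function.update p e 1) (hp.update e zero_le_one le_rfl) a₁)

/-- Row (LEAF-½) at a pendant root from `MixedSign`. -/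
theorem LeafRow_pendant_root_of_mixedSign {o a₂ v b : V} (H : MixedSign (R := R) ends o a₂ v b)
    {p : E → R} (hp : IsProbVec p) {e : E} {z : V} (hleaf : ∀ f, a₂ ∈ ends f → f = e)
    (hends : ends e = s(a₂, z)) {a₁ : V} (ho : o ≠ a₂) (h1 : a₁ ≠ a₂) (hv : v ≠ a₂) (hb : b ≠ a₂)
    (hrow : LeafRow (Function.update p e 1) ends o a₁ a₂ v b) : LeafRow p ends o a₁ a₂ v b :=
  LeafRow_pendant_root_of_bernStep (bernStep_of_mixedSign H) hp hleaf hends ho h1 hv hb hrow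

/-- Row (LEAF-½) at a pendant root from `RBP1`. -/
theorem LeafRow_pendant_root_of_rbp1 {o a₂ v b : V} (H : RBP1 (R := R) ends o a₂ v b)
    {p : E → R} (hp : IsProbVec p) {e : E} {z : V} (hleaf : ∀ f, a₂ ∈ ends f → f = e)
    (hends : ends e = s(a₂, z)) {a₁ : V} (ho : o ≠ a₂) (h1 : a₁ ≠ a₂) (hv : v ≠ a₂) (hb : b ≠ a₂)
    (hrow : LeafRow (Function.update p e 1) ends o a₁ a₂ v b) : LeafRow p ends o a₁ a₂ v b :=
  LeafRow_pendant_root_of_bernStep (bernStep_of_rbp1 H) hp hleaf hends ho h1 hv hb hrow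

end Main

end CrossAPrimeChain

end Summit.Ventures.PercRepro2
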